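import Mathlib.NumberTheory.Padics.HeightOneSpectrum
import Literature.NumberTheory.EllipticCurves.TwoDescentKummerBridgeGoodPlace
import Literature.NumberTheory.EllipticCurves.TwoDescentLocalPadic
import Literature.NumberTheory.EllipticCurves.KramerTwoDescentSquares
import HarnessLib

/-!
# Selmer classes over `ℚ` have even `ℓ`-adic valuation at the good odd primes

The abstract statement `even_v_of_mem_selmerGroup` (`TwoDescentKummerBridgeGoodPlace.lean`) is
instantiated at the finite places of `ℚ`: the tree's completion `v.adicCompletion ℚ` at
`v : HeightOneSpectrum (𝓞 ℚ)` is identified with `ℚ_[ℓ]` (`ℓ = primesEquiv v`) by Mathlib's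
continuous `ℚ`-algebra isomorphism `Rat.HeightOneSpectrum.adicCompletion.padicEquiv`, and the
tree's `ℓ`-adic odd place `padicPlace ℓ : OddPlace ℚ_[ℓ]` (`TwoDescentLocalPadic.lean`) is pulled back
along it (`adicOddPlace v`, with `v(algebraMap ℚ _ a) = padicValRat ℓ a`). Hence, for an elliptic
curve `E/ℚ` with rational `2`-torsion `e₁, e₂, e₃`, a class `c ∈ Sel⁽²⁾(E/ℚ)` with global
`T₁`-component `[a]` (`a ∈ ℚˣ`) has **`v_ℓ(a)` even at every odd prime `ℓ` with
`v_ℓ(e₁ - e₂) = v_ℓ(e₁ - e₃) = 0`** (`even_padicValRat_of_mem_selmerGroup`) — the content of Silverman's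
`Sel⁽²⁾ ⊆ ℚ(S, 2) × ℚ(S, 2)` at the primes `ℓ ∉ S`. Definitions with bodies and theorems only; no
named fact. Cell `bsd-monsky` (towards `#Sel⁽²⁾(E_{2pq}) ≤ 8`).

## References

* [SilvermanAEC2009] J. H. Silverman, *The Arithmetic of Elliptic Curves*, 2nd ed., GTM 106,
  Springer 2009, Prop. X.1.4, Prop. X.4.9, Example X.4.10.
-/

noncomputable section

open scoped Classical

open Field IsDedekindDomain NumberField Rat.HeightOneSpectrum
open Literature.NumberTheory.EllipticCurves.TwoDescentLocal

namespace WeierstrassCurve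

open Literature.NumberTheory.GaloisRepresentations Literature.NumberTheory.EllipticCurves

/-- The prime number `ℓ` of a finite place `v` of `ℚ` is prime (`Nat.Primes`).
[cite: SilvermanAEC2009, X.§1 (Example X.1.5)] -/
theorem fact_prime_primesEquiv (v : HeightOneSpectrum (𝓞 ℚ)) : Fact (primesEquiv v : ℕ).Prime :=
  ⟨(primesEquiv v).2⟩

/-- **The odd place of `v.adicCompletion ℚ`**: the tree's `ℓ`-adic place `padicPlace ℓ` on `ℚ_[ℓ]`
pulled back along Mathlib's isomorphism `v.adicCompletion ℚ ≃A[ℚ] ℚ_[ℓ]`, `ℓ = primesEquiv v`.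
[cite: SilvermanAEC2009, X.§1 (Example X.1.5: square classes of `ℚ_p`)] -/
def adicOddPlace (v : HeightOneSpectrum (𝓞 ℚ)) : OddPlace (v.adicCompletion ℚ) :=
  haveI := fact_prime_primesEquiv v
  (padicPlace (primesEquiv v : ℕ)).comap (adicCompletion.padicEquiv v).toAlgEquiv.toRingEquiv.toRingHom

/-- On rationals the valuation of `adicOddPlace v` is `padicValRat ℓ`. [cite: SilvermanAEC2009, X.§1] -/
theorem adicOddPlace_v_algebraMap (v : HeightOneSpectrum (𝓞 ℚ)) (a : ℚ) :
    haveI := fact_prime_primesEquiv v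
    (adicOddPlace v).v (algebraMap ℚ (v.adicCompletion ℚ) a) = padicValRat (primesEquiv v : ℕ) a := by
  haveI := fact_prime_primesEquiv v
  show (padicPlace (primesEquiv v : ℕ)).v ((adicCompletion.padicEquiv v).toAlgEquiv.toRingEquiv.toRingHom
    (algebraMap ℚ (v.adicCompletion ℚ) a)) = _
  rw [RingEquiv.toRingHom_eq_coe, RingHom.coe_coe, AlgEquiv.coe_ringEquiv, AlgEquiv.commutes,
    eq_ratCast]
  exact padicPlace_v_ratCast _ a


/-- **Selmer classes over `ℚ` have even valuation at the good odd primes** (Silverman AEC Prop. X.1.4,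
`Sel⁽²⁾ ⊆ ℚ(S, 2)²`): for `E/ℚ` with rational `2`-torsion `e₁, e₂, e₃`, a class `c ∈ Sel⁽²⁾(E/ℚ)`
with global `T₁`-component `[a]` (`a ∈ ℚˣ`), and a finite place `v` of `ℚ` over the prime
`ℓ = primesEquiv v` with `v_ℓ(e₁ - e₂) = v_ℓ(e₁ - e₃) = 0`, `v_ℓ(a)` is even.
[cite: SilvermanAEC2009, Prop. X.1.4, Prop. X.4.9] -/
theorem even_padicValRat_of_mem_selmerGroup (W : WeierstrassCurve ℚ) [W.IsElliptic] {e₁ e₂ e₃ : ℚ}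
    (h : W.toAffine.SplitTwoTorsion e₁ e₂ e₃) {c : galH1Torsion W 2} (hc : c ∈ selmerGroup W 2)
    (v : HeightOneSpectrum (𝓞 ℚ))
    (hv₁₂ : haveI := fact_prime_primesEquiv v; padicValRat (primesEquiv v : ℕ) (e₁ - e₂) = 0)
    (hv₁₃ : haveI := fact_prime_primesEquiv v; padicValRat (primesEquiv v : ℕ) (e₁ - e₃) = 0)
    (a : ℚˣ) (ha : kummerEquiv ℚ 2 (W.twoTorsionCharH1 h c) = Additive.ofMul (QuotientGroup.mk a)) :
    haveI := fact_prime_primesEquiv v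
    Even (padicValRat (primesEquiv v : ℕ) (a : ℚ)) := by
  haveI := fact_prime_primesEquiv v
  haveI : CharZero (Place.Completion (Sum.inr v : Place ℚ)) :=
    charZero_of_injective_algebraMap (algebraMap ℚ (v.adicCompletion ℚ)).injective
  haveI : (W.baseChange (Place.Completion (Sum.inr v : Place ℚ))).IsElliptic :=
    W.isElliptic_baseChange _
  have h12 : (adicOddPlace v).v (algebraMap ℚ (v.adicCompletion ℚ) e₁ -
      algebraMap ℚ (v.adicCompletion ℚ) e₂) = 0 := by
    rw [← map_sub, adicOddPlace_v_algebraMap]; exact hv₁₂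
  have h13 : (adicOddPlace v).v (algebraMap ℚ (v.adicCompletion ℚ) e₁ -
      algebraMap ℚ (v.adicCompletion ℚ) e₃) = 0 := by
    rw [← map_sub, adicOddPlace_v_algebraMap]; exact hv₁₃
  have key : Even ((adicOddPlace v).v (algebraMap ℚ (v.adicCompletion ℚ) (a : ℚ))) :=
    W.even_v_of_mem_selmerGroup h hc (Sum.inr v : Place ℚ) (adicOddPlace v) h12 h13 a ha
  rwa [adicOddPlace_v_algebraMap] at key


/-- **Selmer components over `ℚ` are `S`-units modulo squares** (Silverman AEC Prop. X.1.4,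
`Sel⁽²⁾ ⊆ ℚ(S, 2)²`): let `S` be a finite set of primes containing every prime `ℓ` with
`v_ℓ(e₁ - e₂) ≠ 0` or `v_ℓ(e₁ - e₃) ≠ 0`. If `c ∈ Sel⁽²⁾(E/ℚ)` has global `T₁`-component `[a]`,
then `|a| = (∏ T) · r²` for a subset `T ⊆ S` (the primes of `S` at which `a` has odd valuation):
`a` lies in `± ∏ T · ℚˣ²`, one of `2^{|S| + 1}` square classes.
[cite: SilvermanAEC2009, Prop. X.1.4, Thm. X.1.1(c)] -/
theorem exists_subset_abs_eq_prod_mul_sq_of_mem_selmerGroup (W : WeierstrassCurve ℚ) [W.IsElliptic]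
    {e₁ e₂ e₃ : ℚ} (h : W.toAffine.SplitTwoTorsion e₁ e₂ e₃) (S : Finset ℕ) (hS : ∀ q ∈ S, q.Prime)
    (hgood : ∀ ℓ : ℕ, (hℓ : ℓ.Prime) → ℓ ∉ S → haveI : Fact ℓ.Prime := ⟨hℓ⟩;
      padicValRat ℓ (e₁ - e₂) = 0 ∧ padicValRat ℓ (e₁ - e₃) = 0)
    {c : galH1Torsion W 2} (hc : c ∈ selmerGroup W 2) (a : ℚˣ)
    (ha : kummerEquiv ℚ 2 (W.twoTorsionCharH1 h c) = Additive.ofMul (QuotientGroup.mk a)) :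
    ∃ T ⊆ S, ∃ r : ℚ, r ≠ 0 ∧ |(a : ℚ)| = (∏ q ∈ T, (q : ℚ)) * r ^ 2 := by
  classical
  -- the primes of `S` at which `a` has odd valuation
  let T : Finset ℕ := S.filter fun q => ¬ Even (padicValRat q (a : ℚ))
  have hT : T ⊆ S := Finset.filter_subset _ _
  have hTp : ∀ q ∈ T, q.Prime := fun q hq => hS q (hT hq)
  have habs : ∀ p : ℕ, padicValRat p |(a : ℚ)| = padicValRat p (a : ℚ) := by
    intro p
    rcases abs_choice (a : ℚ) with h1 | h1 <;> rw [h1]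
    rw [padicValRat.neg]
  have hpos : (0 : ℚ) < |(a : ℚ)| := abs_pos.mpr a.ne_zero
  obtain ⟨r, hr⟩ := Literature.NumberTheory.EllipticCurves.KramerTwoDescent.exists_eq_prod_mul_sq hTp
    hpos (fun p hp => by
      haveI : Fact p.Prime := ⟨hp⟩
      rw [habs]
      by_cases hpS : p ∈ S
      · constructor
        · intro hev hpT
          exact (Finset.mem_filter.mp hpT).2 hev
        · intro hpT
          by_contra hne
          exact hpT (Finset.mem_filter.mpr ⟨hpS, hne⟩)
      · refine ⟨fun _ hpT => hpS (hT hpT), fun _ => ?_⟩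
        -- `p ∉ S`: even valuation by the local bridge at the place over `p`
        obtain ⟨h12, h13⟩ := hgood p hp hpS
        set v : HeightOneSpectrum (𝓞 ℚ) := primesEquiv.symm ⟨p, hp⟩ with hv
        have hpv : (primesEquiv v : ℕ) = p := by rw [hv, Equiv.apply_symm_apply]
        have := W.even_padicValRat_of_mem_selmerGroup h hc v (by rw [hpv]; exact h12)
          (by rw [hpv]; exact h13) a ha
        rwa [hpv] at this)
  refine ⟨T, hT, r, ?_, hr⟩
  intro hr0
  rw [hr0, zero_pow two_ne_zero, mul_zero] at hr
  exact hpos.ne' hr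

end WeierstrassCurve

end
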